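import Mathlib
import Summits.Ventures.PercRepro2.Defs
import Summits.Ventures.PercRepro2.Independence
import Summits.Ventures.PercRepro2.CoinDefs
import Summits.Ventures.PercRepro2.CoinReverse
import Summits.Ventures.PercRepro2.CoinInduced
import Summits.Ventures.PercRepro2.CoinPendantDefs
import Summits.Ventures.PercRepro2.CoinTraceLevels
import Summits.Ventures.PercRepro2.CoinLsmCoreDefs
import Summits.Ventures.PercRepro2.CoinLsmCoreU
import Summits.Ventures.PercRepro2.CoinOrTailDefs

/-!
# An OR-tail on ONE closed-in core: structure and the level factorisation (blind cell
PercRepro2, night-2 g9; proofs/NIGHT2-DARC.md §37)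

`OrTailU arcs s U p q a cρ cτ`: a closed-in core `U` of `s` (every arc into `U ∪ {s}` has its tail
in `U ∪ {s}`; pairs at the root allowed), two vertices `p, q ∈ U`, and a tail `a ∉ U` entered ONLY
by the single-arc coins `cρ = {p → a}`, `cτ = {q → a}`.  No branch structure is assumed: `p` and
`q` may be connected inside `U`.  The level of `U ∪ {a}` factorises through the level of `U` and
the tail event (`prob_coreLevel_eq`): the core coins of `U` and the two tail coins are disjoint.
This is the general form of `OrTailCore` (CoinOrTailDefs.lean): two disjoint branches form one
closed-in core whose law is the product law.
-/

namespace Summit.Ventures.PercRepro2.Coin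

open Classical

section OrTailUStructure

variable {V : Type*} {E : Type*} [DecidableEq V]

/-- An OR-tail on one closed-in core: `U` closed-in below `s`, `p, q ∈ U`, the tail `a` entered
only by `cρ = {p → a}` and `cτ = {q → a}`. -/
structure OrTailU (arcs : E → Finset (V × V)) (s : V) (U : Finset V) (p q a : V)
    (cρ cτ : E) : Prop where
  p_mem : p ∈ U
  q_mem : q ∈ U
  s_notin : s ∉ U
  a_notin : a ∉ U
  a_ne_s : a ≠ s
  into_U : ∀ e, ∀ xy ∈ arcs e, xy.2 ∈ U → xy.1 ∈ U ∨ xy.1 = s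
  into_s : ∀ e, ∀ xy ∈ arcs e, xy.2 = s → xy.1 ∈ U ∨ xy.1 = s
  into_a : ∀ e, ∀ xy ∈ arcs e, xy.2 = a → (e = cρ ∧ xy.1 = p) ∨ (e = cτ ∧ xy.1 = q)
  arcs_ρ : arcs cρ = {(p, a)}
  arcs_τ : arcs cτ = {(q, a)}
  ρτ_ne : cρ ≠ cτ

variable {arcs : E → Finset (V × V)} {s : V} {U : Finset V} {p q a : V} {cρ cτ : E}

omit [DecidableEq V] in
/-- `p ≠ a`. -/
lemma OrTailU.p_ne_a (h : OrTailU arcs s U p q a cρ cτ) : p ≠ a :=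
  fun e => h.a_notin (e ▸ h.p_mem)

omit [DecidableEq V] in
/-- `q ≠ a`. -/
lemma OrTailU.q_ne_a (h : OrTailU arcs s U p q a cρ cτ) : q ≠ a :=
  fun e => h.a_notin (e ▸ h.q_mem)

/-- The whole core `U ∪ {a}` is a closed-in core (pairs at the root allowed). -/
lemma OrTailU.closedInCoreU (h : OrTailU arcs s U p q a cρ cτ) :
    ClosedInCoreU arcs s (insert a U) where
  into_C := by
    intro e xy hxy hy
    simp only [Finset.mem_insert] at hy ⊢
    rcases hy with hy | hy
    · rcases h.into_a e xy hxy hy with ⟨_, hx⟩ | ⟨_, hx⟩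
      · exact Or.inl (Or.inr (hx ▸ h.p_mem))
      · exact Or.inl (Or.inr (hx ▸ h.q_mem))
    · rcases h.into_U e xy hxy hy with hx | hx
      · exact Or.inl (Or.inr hx)
      · exact Or.inr hx
  into_s := by
    intro e xy hxy hy
    simp only [Finset.mem_insert]
    rcases h.into_s e xy hxy hy with hx | hx
    · exact Or.inl (Or.inr hx)
    · exact Or.inr hx
  s_notin := by
    simp only [Finset.mem_insert, not_or]
    exact ⟨h.a_ne_s.symm, h.s_notin⟩

omit [DecidableEq V] in
/-- An open arc into `a` is the tail coin `cρ` from `p` or the tail coin `cτ` from `q`. -/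
lemma OrTailU.openArc_a_iff (h : OrTailU arcs s U p q a cρ cτ) {ω : Config E} {x : V} :
    OpenArc arcs ω x a ↔ (x = p ∧ ω cρ = true) ∨ (x = q ∧ ω cτ = true) := by
  constructor
  · rintro ⟨e, he, hxa⟩
    rcases h.into_a e (x, a) hxa rfl with ⟨rfl, hx⟩ | ⟨rfl, hx⟩
    · exact Or.inl ⟨hx, he⟩
    · exact Or.inr ⟨hx, he⟩
  · rintro (⟨rfl, he⟩ | ⟨rfl, he⟩)
    · exact ⟨cρ, he, by rw [h.arcs_ρ]; exact Finset.mem_singleton_self _⟩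
    · exact ⟨cτ, he, by rw [h.arcs_τ]; exact Finset.mem_singleton_self _⟩

omit [DecidableEq V] in
/-- **The tail is reached iff one of its two entries is reached and its coin open.** -/
lemma OrTailU.reach_a_iff (h : OrTailU arcs s U p q a cρ cτ) {ω : Config E} :
    Reach arcs ω s a ↔
      (Reach arcs ω s p ∧ ω cρ = true) ∨ (Reach arcs ω s q ∧ ω cτ = true) := by
  constructor
  · intro hr
    rcases Relation.ReflTransGen.cases_tail hr with hsa | ⟨x, hsx, hxa⟩
    · exact absurd hsa h.a_ne_s
    · rcases h.openArc_a_iff.1 hxa with ⟨rfl, he⟩ | ⟨rfl, he⟩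
      · exact Or.inl ⟨hsx, he⟩
      · exact Or.inr ⟨hsx, he⟩
  · rintro (⟨hsp, he⟩ | ⟨hsq, he⟩)
    · exact reach_trans hsp (reach_of_openArc (h.openArc_a_iff.2 (Or.inl ⟨rfl, he⟩)))
    · exact reach_trans hsq (reach_of_openArc (h.openArc_a_iff.2 (Or.inr ⟨rfl, he⟩)))

/-- **The level factorisation (as events)**: the level of `U ∪ {a}` at `W` is the level of `U` at
`W ∩ U` intersected with the tail event. -/
theorem OrTailU.coreLevel_eq (h : OrTailU arcs s U p q a cρ cτ) (W : Finset V) :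
    coreLevel arcs s (insert a U) W = coreLevel arcs s U (W ∩ U) ∩ tailEvent p q a cρ cτ W := by
  ext ω
  simp only [Set.mem_inter_iff, mem_coreLevel, mem_tailEvent, Finset.mem_inter, Finset.mem_insert]
  constructor
  · intro hW
    refine ⟨fun z hz => ?_, ?_⟩
    · rw [and_iff_left hz]; exact hW z (Or.inr hz)
    · rw [hW a (Or.inl rfl), h.reach_a_iff, hW p (Or.inr h.p_mem), hW q (Or.inr h.q_mem)]
  · rintro ⟨h1, h3⟩ z hz
    rcases hz with rfl | hz
    · rw [h3, h.reach_a_iff, ← and_iff_left (a := p ∈ W) h.p_mem, h1 p h.p_mem,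
        ← and_iff_left (a := q ∈ W) h.q_mem, h1 q h.q_mem]
    · rw [← and_iff_left (a := z ∈ W) hz]; exact h1 z hz

/-- The tail coins carry no arc into `U`. -/
lemma OrTailU.disjoint_tailCoins (h : OrTailU arcs s U p q a cρ cτ) :
    Disjoint (coreCoins arcs U) ({cρ, cτ} : Set E) := by
  rw [Set.disjoint_right]
  intro e he hmem
  simp only [Set.mem_insert_iff, Set.mem_singleton_iff] at he
  obtain ⟨xy, hxy, hy⟩ := mem_coreCoins.mp hmem
  rcases he with rfl | rfl
  · rw [h.arcs_ρ, Finset.mem_singleton] at hxy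
    subst hxy
    exact h.a_notin hy
  · rw [h.arcs_τ, Finset.mem_singleton] at hxy
    subst hxy
    exact h.a_notin hy

end OrTailUStructure

section OrTailUProb

variable {V : Type*} {E : Type*} [DecidableEq V] [Fintype E] [DecidableEq E]
  {R : Type*} [CommRing R]
  {arcs : E → Finset (V × V)} {s : V} {U : Finset V} {p q a : V} {cρ cτ : E}

/-- **The level factorisation (probabilities)**: the level of `U` and the tail event are
independent. -/
theorem OrTailU.prob_coreLevel_eq (h : OrTailU arcs s U p q a cρ cτ) (pr : E → R)
    (W : Finset V) :
    prob pr (coreLevel arcs s (insert a U) W) =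
      prob pr (coreLevel arcs s U (W ∩ U)) * prob pr (tailEvent p q a cρ cτ W) := by
  rw [h.coreLevel_eq W,
    prob_inter_eq_mul_of_dependsOn pr h.disjoint_tailCoins
      (dependsOn_coreLevel_of_into h.into_U _) (dependsOn_tailEvent p q a cρ cτ W)]

end OrTailUProb

end Summit.Ventures.PercRepro2.Coin
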